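import Summits.QuantumFields.QCD.Theses.QuarksAsStableAction
import Summits.QuantumFields.QCD.Theses.WilsonQuarkChessboard
import Literature.MathematicalPhysics.QuantumLattice.WilsonDiracAP
import Summits.QuantumFields.QCD.Theorems.QuarksAsStableActionCriticalLineDiamagnetismStubHadamardUpper
import Summits.QuantumFields.QCD.Theorems.QuarksAsStableActionCriticalLineDiamagnetismStubFreeDetFormula
import Summits.QuantumFields.QCD.Theorems.QuarksAsStableActionCriticalLineDiamagnetismStubFreeSymbolSum
import Summits.QuantumFields.QCD.Theorems.QuarksAsStableActionCriticalLineDiamagnetismStubCellIncidence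
import Summits.QuantumFields.QCD.Theorems.QuarksAsStableActionCriticalLineDiamagnetismStubQuarkChessboardOfSchwarz
import Summits.QuantumFields.QCD.Theorems.QuarksAsStableActionCriticalLineDiamagnetismStubCellGainOfGauged
import Summits.QuantumFields.QCD.Theorems.QuarksAsStableActionCriticalLineDiamagnetismStubBlochFactorisation
import Summits.QuantumFields.QCD.Theorems.QuarksAsStableActionCriticalLineDiamagnetismStubFreeBlochBlocks
import Summits.QuantumFields.QCD.Theorems.QuarksAsStableActionCriticalLineDiamagnetismStubCellDetFactorisation
import Summits.QuantumFields.QCD.Theorems.QuarksAsStableActionCriticalLineDiamagnetismStubDetPerturbIR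
import Summits.QuantumFields.QCD.Theorems.QuarksAsStableActionCriticalLineDiamagnetismStubLogDetSecondOrder
import Summits.QuantumFields.QCD.Theorems.QuarksAsStableActionCriticalLineDiamagnetismStubDeltaBounds
import Summits.QuantumFields.QCD.Theorems.QuarksAsStableActionCriticalLineDiamagnetismStubBlochLatticeSum
import Summits.QuantumFields.QCD.Theorems.QuarksAsStableActionCriticalLineDiamagnetismStubTilingCellData
import Summits.QuantumFields.QCD.Theorems.QuarksAsStableActionCriticalLineDiamagnetismStubCellGainTilingGlue
import Summits.QuantumFields.QCD.Theorems.QuarksAsStableActionCriticalLineDiamagnetismStubBlockEstimate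
import Summits.QuantumFields.QCD.Theorems.QuarksAsStableActionCriticalLineDiamagnetismStubCellGainCore
import Summits.QuantumFields.QCD.Theorems.QuarksAsStableActionCriticalLineDiamagnetismStubCellRegauge
import Summits.QuantumFields.QCD.Theorems.QuarksAsStableActionCriticalLineDiamagnetismStubBackgroundSchwarz

/-!
# The chessboard / cell-gain reduction of `CriticalLineDiamagnetism`
(helper for crux stmt-QuantumFields-9734, line `Sketch`, stub `stub_reduction`)

The durable, kernel-checked composition of the line `Sketch` for the crux
`Summit.QuantumFields.QCD.Theses.QuarksAsStableAction.CriticalLineDiamagnetism`: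
`OneLoopMargin → OddHalf → CriticalLineDiamagnetism`, where `OneLoopMargin` (stub P6, the one-loop margin of
the Wilson vacuum polarisation in Bloch-block form — the honest residual of the line) and `OddHalf` (the crux
restricted to odd tori — no reflection engine) are the two hypotheses, and everything else is a landed theorem
of this line: the quark chessboard (`stub_quarkChessboard_of_schwarz stub_backgroundSchwarz`, items 10349 ⇒ 9306),
the one-cell gain `stub_cellGain_of_gauged ∘ stub_cellGainTilingGlue ∘ stub_cellRegauge ∘ stub_cellGainCore`
(P6 ⇒ plaquette form of the gain), Hadamard per bad cell (`stub_hadamardUpper`), the free antiperiodic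
determinant from below (`stub_freeDetFormula`, `stub_freeSymbolSum`) and cell incidence (`stub_cellIncidence`).

## The argument (`Reduction.evenHalf_of_cellGain`, `Reduction.crux_of_halves`)

For even `L ≥ L₀`, `|m| ≤ ε`, `U : SU(3)` field, let `V = unitaryLift U` (the same links in `U(3)`); the crux's
inlined antiperiodic lift is the stubs' seam twist of `V` (`Reduction.apField_eq`) and its deficits are those of
`V` (`Reduction.deficit_unitaryLift`).  Then `‖dAP V‖ ^ (L⁴) ≤ ∏_c Re dAP (tile c V)` (chessboard), and cell by
cell: if all plaquettes of the closed unit cell `c` are `δ₀`-good, `Re dAP (tile c V) ≤ exp(K₀ − c·(L⁴/4)·Σ_{p ∈ c}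
dfc p)·‖dAP 1‖` (cell gain); otherwise `Re dAP (tile c V) ≤ ‖dAP (tile c V)‖ ≤ e^{h₁L⁴} ≤ e^{(H₁+H₂)L⁴}‖dAP 1‖`
(Hadamard, and `‖dAP 1‖ = ∏_k h_m(k)^6 ≥ e^{−h₂L⁴}`).  Summing the exponents (`Reduction.sum_cells_le`: each
plaquette lies in exactly 4 closed unit cells, a cell has ≤ 24 plaquettes, deficits in `[0, 6]`):
`#bad cells ≤ 4 N_bad`, `Σ_{good c} Σ_{p ∈ c} dfc ≥ 4 S_good − 576 N_bad`, so
`Σ_c exponent ≤ L⁴ (|K₀| − c S_good + (4(H₁+H₂) + 144 c) N_bad)`, and the `L⁴`-th root is the crux on even tori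
with `ε = min ε₁ ε₂ ½`, `δ = δ₀`, `c₁ = c`, `K = |K₀|`, `C = 4(H₁ + H₂) + 144 c`.  Even and odd halves merge by
monotonicity of the exponent in `(δ, c₁, K, C)` (`Reduction.exponent_mono`).

Refactoring (pure theorem file: no definitions, no local notation) of the lead's skeleton
`Cruxes/CriticalLineDiamagnetism/Lines/Sketch.lean` (v10), whose sorry-free composition this is; worker 5a of
prover-line-stmt-QuantumFields-9734-c1, 2026-08-16.  The audit reports `proof.conditional` for `stub_reduction`
and `evenHalf_of_oneLoopMargin`: that is the point (a conditional reduction to the two open stubs).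
-/

noncomputable section

open scoped BigOperators Classical Matrix ComplexConjugate
open Finset
open Literature.MathematicalPhysics.QuantumLattice Literature.MathematicalPhysics.QuantumFieldTheory
  Literature.Probability.LatticeModels

namespace Summit.QuantumFields.QCD.Cruxes.CriticalLineDiamagnetism.ChessboardCellGain

namespace Reduction

variable {L : ℕ}

/-- The crux's inlined antiperiodic `U(3)` lift of an `SU(3)` field (seam `x_μ = -1`) is the
`val x_μ + 1 = L` seam twist of the plain lift `unitaryLift U` used by the stubs. -/
theorem apField_eq [NeZero L] (U : GaugeConfig 4 L (Matrix.specialUnitaryGroup (Fin 3) ℂ)) :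
    (fun e : Edge 4 L => if e.1 e.2 = -1 then
        -(⟨(U e).1, Matrix.specialUnitaryGroup_le_unitaryGroup (U e).2⟩ : Matrix.unitaryGroup (Fin 3) ℂ)
      else ⟨(U e).1, Matrix.specialUnitaryGroup_le_unitaryGroup (U e).2⟩) =
    fun e : Edge 4 L => if (e.1 e.2).val + 1 = L then -(unitaryLift U e) else unitaryLift U e := by
  funext e
  simp only [FreeDetFormula.val_add_one_eq_iff]
  rfl

/-- The crux's `SU(3)`-side plaquette deficit is the `U(3)`-side deficit of the plain lift. -/
theorem deficit_unitaryLift (U : GaugeConfig 4 L (Matrix.specialUnitaryGroup (Fin 3) ℂ)) (p : Plaquette 4 L) :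
    3 - (fundamentalRep (Fin 3) (plaquetteHolonomy U p.1 p.2.1.1 p.2.1.2)).trace.re =
      3 - (unitaryFundamentalRep (Fin 3) ℂ (plaquetteHolonomy (unitaryLift U) p.1 p.2.1.1 p.2.1.2)).trace.re := by
  have h : plaquetteHolonomy (unitaryLift U) p.1 p.2.1.1 p.2.1.2 =
      suInclusion (N := 3) (plaquetteHolonomy U p.1 p.2.1.1 p.2.1.2) := by
    simp only [plaquetteHolonomy, unitaryLift_apply, map_mul, map_inv]
  rw [h]
  rfl

/-- Plaquette deficits `3 − Re tr V_p` of `U(3)` fields lie in `[0, 6]`. -/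
theorem deficit_mem (V : GaugeConfig 4 L (Matrix.unitaryGroup (Fin 3) ℂ)) (p : Plaquette 4 L) :
    0 ≤ 3 - (unitaryFundamentalRep (Fin 3) ℂ (plaquetteHolonomy V p.1 p.2.1.1 p.2.1.2)).trace.re ∧
      3 - (unitaryFundamentalRep (Fin 3) ℂ (plaquetteHolonomy V p.1 p.2.1.1 p.2.1.2)).trace.re ≤ 6 := by
  have h0 := plaquetteDeficit_nonneg (unitaryFundamentalRep (Fin 3) ℂ) unitaryFundamentalRep_mem_unitaryGroup V p
  have h6 := plaquetteDeficit_le (unitaryFundamentalRep (Fin 3) ℂ) unitaryFundamentalRep_mem_unitaryGroup V p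
  simp only [plaquetteDeficit, Nat.cast_ofNat] at h0 h6
  exact ⟨h0, by linarith⟩

/-- Monotonicity of the crux exponent `K − c₁·S_good(δ) + C·N_bad(δ)` in its constants, for non-negative
deficits: shrinking `δ` and `c₁ ≥ 0`, growing `K` and `C` (to a non-negative value). -/
theorem exponent_mono {ι : Type*} [Fintype ι] {d : ι → ℝ} (hd : ∀ i, 0 ≤ d i) {δ δ' c c' K K' C C' : ℝ}
    (hδ : δ' ≤ δ) (hc : c' ≤ c) (hc' : 0 ≤ c') (hK : K ≤ K') (hC : C ≤ C') (hC' : 0 ≤ C') :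
    K - c * (∑ i ∈ univ.filter (fun i => d i < δ), d i) + C * ((univ.filter (fun i => δ ≤ d i)).card : ℝ) ≤
      K' - c' * (∑ i ∈ univ.filter (fun i => d i < δ'), d i) + C' * ((univ.filter (fun i => δ' ≤ d i)).card : ℝ) := by
  have hS : (∑ i ∈ univ.filter (fun i => d i < δ'), d i) ≤ ∑ i ∈ univ.filter (fun i => d i < δ), d i := by
    apply Finset.sum_le_sum_of_subset_of_nonneg
    · intro i hi
      simp only [Finset.mem_filter] at hi ⊢
      exact ⟨hi.1, lt_of_lt_of_le hi.2 hδ⟩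
    · exact fun i _ _ => hd i
  have hS0 : 0 ≤ ∑ i ∈ univ.filter (fun i => d i < δ'), d i := Finset.sum_nonneg fun i _ => hd i
  have hN : ((univ.filter (fun i => δ ≤ d i)).card : ℝ) ≤ ((univ.filter (fun i => δ' ≤ d i)).card : ℝ) := by
    exact_mod_cast Finset.card_le_card (fun i hi => by
      simp only [Finset.mem_filter] at hi ⊢
      exact ⟨hi.1, le_trans hδ hi.2⟩)
  have hN0 : (0 : ℝ) ≤ ((univ.filter (fun i => δ ≤ d i)).card : ℝ) := by positivity
  have h1 : c' * (∑ i ∈ univ.filter (fun i => d i < δ'), d i) ≤ c * ∑ i ∈ univ.filter (fun i => d i < δ), d i :=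
    mul_le_mul hc hS hS0 (le_trans hc' hc)
  have h2 : C * ((univ.filter (fun i => δ ≤ d i)).card : ℝ) ≤ C' * ((univ.filter (fun i => δ' ≤ d i)).card : ℝ) :=
    le_trans (mul_le_mul_of_nonneg_right hC hN0) (mul_le_mul_of_nonneg_left hN hC')
  linarith

/-- **Cell bookkeeping (abstract form).**  Cells `c : α`, plaquettes `p : ι`, incidence `P c p`, deficits
`d p ∈ [0, 6]`, every plaquette in exactly `4` cells, at most `24` plaquettes per cell, `card α ≤ L4`.  If the
exponent `f c` of a cell all of whose plaquettes are `δ₀`-good is at most `K₀ − cg·(L4/4)·Σ_{p ∈ c} d p` and that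
of any other cell is at most `H·L4`, then `Σ_c f c ≤ L4·(|K₀| − cg·S_good + (4H + 144 cg)·N_bad)`
(`#bad cells ≤ 4 N_bad`, `Σ_{good c} Σ_{p ∈ c} d ≥ 4 Σ_p d − 144·#bad cells`). -/
theorem sum_cells_le {α ι : Type*} [Fintype α] [Fintype ι] (P : α → ι → Prop) [∀ c p, Decidable (P c p)]
    (d : ι → ℝ) (hd : ∀ p, 0 ≤ d p ∧ d p ≤ 6) {K₀ cg H δ₀ L4 : ℝ} (hcg : 0 ≤ cg) (hH : 0 ≤ H) (hL4 : 0 ≤ L4)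
    (hα : (Fintype.card α : ℝ) ≤ L4) (hCellCard : ∀ c, (univ.filter (fun p => P c p)).card ≤ 24)
    (hFour : ∀ p, (univ.filter (fun c => P c p)).card = 4) (f : α → ℝ)
    (hfg : ∀ c, (∀ p, P c p → d p < δ₀) → f c ≤ K₀ - cg * (L4 / 4) * ∑ p ∈ univ.filter (fun p => P c p), d p)
    (hfb : ∀ c, ¬ (∀ p, P c p → d p < δ₀) → f c ≤ H * L4) :
    ∑ c, f c ≤ L4 * (|K₀| - cg * (∑ p ∈ univ.filter (fun p => d p < δ₀), d p) +
        (4 * H + 144 * cg) * ((univ.filter (fun p => δ₀ ≤ d p)).card : ℝ)) := by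
  set Sg : ℝ := ∑ p ∈ univ.filter (fun p => d p < δ₀), d p with hSg
  set Nb : ℕ := (univ.filter (fun p => δ₀ ≤ d p)).card with hNb
  -- the bad cells: each contains a bad plaquette, which lies in 4 cells
  have hBcard : ((univ.filter (fun c => ¬ ∀ p, P c p → d p < δ₀)).card : ℝ) ≤ 4 * Nb := by
    have hsub : univ.filter (fun c => ¬ ∀ p, P c p → d p < δ₀) ⊆
        (univ.filter (fun p => δ₀ ≤ d p)).biUnion (fun p => univ.filter (fun c => P c p)) := by
      intro c hc
      have hc' := (Finset.mem_filter.1 hc).2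
      simp only [not_forall, not_lt, exists_prop] at hc'
      obtain ⟨p, hp, hdp⟩ := hc'
      simp only [Finset.mem_biUnion, Finset.mem_filter, Finset.mem_univ, true_and]
      exact ⟨p, hdp, hp⟩
    have h := le_trans (Finset.card_le_card hsub) Finset.card_biUnion_le
    have h' : ∑ p ∈ univ.filter (fun p => δ₀ ≤ d p), (univ.filter (fun c => P c p)).card = 4 * Nb := by
      rw [Finset.sum_congr rfl (fun p _ => hFour p), Finset.sum_const, smul_eq_mul, hNb, mul_comm]
    rw [h'] at h
    exact_mod_cast h
  -- `Σ_c Σ_{p ∈ cell c} d = 4 Σ_p d`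
  have hswap : ∑ c, ∑ p ∈ univ.filter (fun p => P c p), d p = 4 * ∑ p, d p := by
    have : ∀ c, ∑ p ∈ univ.filter (fun p => P c p), d p = ∑ p, if P c p then d p else 0 := fun c => by
      rw [Finset.sum_filter]
    simp_rw [this]
    rw [Finset.sum_comm, Finset.mul_sum]
    refine Finset.sum_congr rfl fun p _ => ?_
    rw [← Finset.sum_filter, Finset.sum_const, nsmul_eq_mul, hFour p]
    push_cast; ring
  have hSall : Sg ≤ ∑ p, d p :=
    Finset.sum_le_sum_of_subset_of_nonneg (Finset.filter_subset _ _) (fun p _ _ => (hd p).1)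
  -- the cell sums of the bad cells are at most `144` each
  have hBsum : ∑ c ∈ univ.filter (fun c => ¬ ∀ p, P c p → d p < δ₀), ∑ p ∈ univ.filter (fun p => P c p), d p ≤
      144 * (univ.filter (fun c => ¬ ∀ p, P c p → d p < δ₀)).card := by
    have : ∀ c ∈ univ.filter (fun c => ¬ ∀ p, P c p → d p < δ₀), ∑ p ∈ univ.filter (fun p => P c p), d p ≤ 144 :=
      fun c _ => by
      calc ∑ p ∈ univ.filter (fun p => P c p), d p ≤ ∑ _p ∈ univ.filter (fun p => P c p), (6 : ℝ) :=
            Finset.sum_le_sum fun p _ => (hd p).2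
        _ = 6 * (univ.filter (fun p => P c p)).card := by rw [Finset.sum_const, nsmul_eq_mul, mul_comm]
        _ ≤ 6 * (24 : ℕ) := by gcongr; exact hCellCard c
        _ = 144 := by norm_num
    refine (Finset.sum_le_sum this).trans ?_
    rw [Finset.sum_const, nsmul_eq_mul, mul_comm]
  -- split the sum over good and bad cells
  have hsplit : ∑ c, f c ≤
      (∑ c ∈ univ.filter (fun c => ∀ p, P c p → d p < δ₀),
          (K₀ - cg * (L4 / 4) * ∑ p ∈ univ.filter (fun p => P c p), d p)) +
        ∑ _c ∈ univ.filter (fun c => ¬ ∀ p, P c p → d p < δ₀), H * L4 := by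
    rw [← Finset.sum_filter_add_sum_filter_not univ (fun c => ∀ p, P c p → d p < δ₀)]
    exact add_le_add (Finset.sum_le_sum fun c hc => hfg c (Finset.mem_filter.1 hc).2)
      (Finset.sum_le_sum fun c hc => hfb c (Finset.mem_filter.1 hc).2)
  have hgoodsum : ∑ c ∈ univ.filter (fun c => ∀ p, P c p → d p < δ₀), ∑ p ∈ univ.filter (fun p => P c p), d p =
      4 * (∑ p, d p) -
        ∑ c ∈ univ.filter (fun c => ¬ ∀ p, P c p → d p < δ₀), ∑ p ∈ univ.filter (fun p => P c p), d p := by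
    rw [← hswap, ← Finset.sum_filter_add_sum_filter_not univ (fun c => ∀ p, P c p → d p < δ₀)]
    ring
  have hK : ((univ.filter (fun c => ∀ p, P c p → d p < δ₀)).card : ℝ) * K₀ ≤ L4 * |K₀| := by
    calc ((univ.filter (fun c => ∀ p, P c p → d p < δ₀)).card : ℝ) * K₀
        ≤ (univ.filter (fun c => ∀ p, P c p → d p < δ₀)).card * |K₀| :=
          mul_le_mul_of_nonneg_left (le_abs_self _) (by positivity)
      _ ≤ L4 * |K₀| := by
          gcongr
          refine le_trans ?_ hα
          exact_mod_cast (Finset.card_filter_le _ _).trans Finset.card_univ.le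
  refine hsplit.trans ?_
  rw [Finset.sum_sub_distrib, ← Finset.mul_sum, hgoodsum, Finset.sum_const, nsmul_eq_mul, Finset.sum_const,
    nsmul_eq_mul]
  -- the arithmetic: `#good·K₀ ≤ L4|K₀|`, `Sg ≤ Σ d`, `T ≤ 144·#bad`, `#bad ≤ 4·Nb`
  have a1 : 0 ≤ cg * L4 * ((∑ p, d p) - Sg) := mul_nonneg (mul_nonneg hcg hL4) (by linarith)
  nlinarith [mul_nonneg (mul_nonneg hcg hL4) (sub_nonneg.2 hBsum), mul_nonneg (mul_nonneg hcg hL4) (sub_nonneg.2 hBcard),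
    mul_nonneg (mul_nonneg hH hL4) (sub_nonneg.2 hBcard), hK, a1]

/-- **The crux from its even and odd halves**, by `exponent_mono` with the common constants
`ε = min, δ = min, c₁ = min, K = max, C = max ⊔ 0, L₀ = max`. -/
theorem crux_of_halves
    (hE : ∃ ε δ c₁ K C : ℝ, 0 < ε ∧ 0 < δ ∧ 0 < c₁ ∧ ∃ L₀ : ℕ, ∀ (L : ℕ) [NeZero L], Even L → L₀ ≤ L → let apDet : Literature.MathematicalPhysics.QuantumFieldTheory.GaugeConfig 4 L (Matrix.specialUnitaryGroup (Fin 3) ℂ) → ℝ → ℂ := fun U m => Literature.MathematicalPhysics.QuantumLattice.fermionDet (Literature.MathematicalPhysics.QuantumLattice.wilsonDirac (Literature.MathematicalPhysics.QuantumLattice.unitaryFundamentalRep (Fin 3) ℂ) (fun e => if e.1 e.2 = -1 then -(⟨(U e).1, Matrix.specialUnitaryGroup_le_unitaryGroup (U e).2⟩ : Matrix.unitaryGroup (Fin 3) ℂ) else ⟨(U e).1, Matrix.specialUnitaryGroup_le_unitaryGroup (U e).2⟩) m 1); let dfc : Literature.MathematicalPhysics.QuantumFieldTheory.GaugeConfig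 4 L (Matrix.specialUnitaryGroup (Fin 3) ℂ) → Literature.MathematicalPhysics.QuantumFieldTheory.Plaquette 4 L → ℝ := fun U p => 3 - (Literature.MathematicalPhysics.QuantumLattice.fundamentalRep (Fin 3) (Literature.MathematicalPhysics.QuantumFieldTheory.plaquetteHolonomy U p.1 p.2.1.1 p.2.1.2)).trace.re; ∀ m : ℝ, |m| ≤ ε → ∀ U : Literature.MathematicalPhysics.QuantumFieldTheory.GaugeConfig 4 L (Matrix.specialUnitaryGroup (Fin 3) ℂ), ‖apDet U m‖ ≤ Real.exp (K - c₁ * (∑ p ∈ Finset.univ.filter (fun p => dfc U p < δ), dfc U p) + C * ((Finset.univ.filter (fun p => δ ≤ dfc U p)).card : ℝ)) * ‖apDet 1 m‖)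
    (hO : ∃ ε δ c₁ K C : ℝ, 0 < ε ∧ 0 < δ ∧ 0 < c₁ ∧ ∃ L₀ : ℕ, ∀ (L : ℕ) [NeZero L], Odd L → L₀ ≤ L → let apDet : Literature.MathematicalPhysics.QuantumFieldTheory.GaugeConfig 4 L (Matrix.specialUnitaryGroup (Fin 3) ℂ) → ℝ → ℂ := fun U m => Literature.MathematicalPhysics.QuantumLattice.fermionDet (Literature.MathematicalPhysics.QuantumLattice.wilsonDirac (Literature.MathematicalPhysics.QuantumLattice.unitaryFundamentalRep (Fin 3) ℂ) (fun e => if e.1 e.2 = -1 then -(⟨(U e).1, Matrix.specialUnitaryGroup_le_unitaryGroup (U e).2⟩ : Matrix.unitaryGroup (Fin 3) ℂ) else ⟨(U e).1, Matrix.specialUnitaryGroup_le_unitaryGroup (U e).2⟩) m 1); let dfc : Literature.MathematicalPhysics.QuantumFieldTheory.GaugeConfig 4 L (Matrix.specialUnitaryGroup (Fin 3) ℂ) → Literature.MathematicalPhysics.QuantumFieldTheory.Plaquette 4 L → ℝ := fun U p => 3 - (Literature.MathematicalPhysics.QuantumLattice.fundamentalRep (Fin 3) (Literature.MathematicalPhysics.QuantumFieldTheory.plaquetteHolonomy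 U p.1 p.2.1.1 p.2.1.2)).trace.re; ∀ m : ℝ, |m| ≤ ε → ∀ U : Literature.MathematicalPhysics.QuantumFieldTheory.GaugeConfig 4 L (Matrix.specialUnitaryGroup (Fin 3) ℂ), ‖apDet U m‖ ≤ Real.exp (K - c₁ * (∑ p ∈ Finset.univ.filter (fun p => dfc U p < δ), dfc U p) + C * ((Finset.univ.filter (fun p => δ ≤ dfc U p)).card : ℝ)) * ‖apDet 1 m‖) :
    Theses.QuarksAsStableAction.CriticalLineDiamagnetism := by
  obtain ⟨ε₁, δ₁, c₁, K₁, C₁, hε₁, hδ₁, hc₁, L₁, h₁⟩ := hE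
  obtain ⟨ε₂, δ₂, c₂, K₂, C₂, hε₂, hδ₂, hc₂, L₂, h₂⟩ := hO
  refine ⟨min ε₁ ε₂, min δ₁ δ₂, min c₁ c₂, max K₁ K₂, max (max C₁ C₂) 0, lt_min hε₁ hε₂, lt_min hδ₁ hδ₂,
    lt_min hc₁ hc₂, max L₁ L₂, ?_⟩
  intro L _ hL apDet dfc m hm U
  have hd : ∀ p : Plaquette 4 L, 0 ≤ dfc U p := fun p => by
    have h := (deficit_mem (unitaryLift U) p).1
    rwa [← deficit_unitaryLift U p] at h
  have hc0 : 0 ≤ min c₁ c₂ := le_of_lt (lt_min hc₁ hc₂)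
  rcases Nat.even_or_odd L with hpar | hpar
  · have h : ‖apDet U m‖ ≤ Real.exp (K₁ - c₁ * (∑ p ∈ Finset.univ.filter (fun p => dfc U p < δ₁), dfc U p) +
        C₁ * ((Finset.univ.filter (fun p => δ₁ ≤ dfc U p)).card : ℝ)) * ‖apDet 1 m‖ :=
      h₁ L hpar (le_trans (le_max_left _ _) hL) m (le_trans hm (min_le_left _ _)) U
    refine le_trans h (mul_le_mul_of_nonneg_right (Real.exp_le_exp.2 ?_) (norm_nonneg _))
    exact exponent_mono hd (min_le_left _ _) (min_le_left _ _) hc0 (le_max_left _ _)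
      (le_trans (le_max_left _ _) (le_max_left _ _)) (le_max_right _ _)
  · have h : ‖apDet U m‖ ≤ Real.exp (K₂ - c₂ * (∑ p ∈ Finset.univ.filter (fun p => dfc U p < δ₂), dfc U p) +
        C₂ * ((Finset.univ.filter (fun p => δ₂ ≤ dfc U p)).card : ℝ)) * ‖apDet 1 m‖ :=
      h₂ L hpar (le_trans (le_max_right _ _) hL) m (le_trans hm (min_le_right _ _)) U
    refine le_trans h (mul_le_mul_of_nonneg_right (Real.exp_le_exp.2 ?_) (norm_nonneg _))
    exact exponent_mono hd (min_le_right _ _) (min_le_right _ _) hc0 (le_max_right _ _)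
      (le_trans (le_max_right _ _) (le_max_left _ _)) (le_max_right _ _)

/-- **The crux on even tori from the one-cell gain** (plaquette form, the conclusion of `stub_cellGain_of_gauged`)
and the landed chessboard, Hadamard, free-determinant and incidence stubs: constants `ε = min ε₁ (min ε₂ ½)`,
`δ = δ₀`, `c₁ = c`, `K = |K₀|`, `C = 4(H₁ + H₂) + 144c` (`Hᵢ = max hᵢ 0`), `L₀ = max (max L₁ L₂) 4`. -/
theorem evenHalf_of_cellGain
    (hCG : ∃ δ₀ c K₀ ε : ℝ, 0 < δ₀ ∧ 0 < c ∧ 0 < ε ∧ ∃ L₀ : ℕ, ∀ (L : ℕ) [NeZero L], Even L → L₀ ≤ L →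
    let dAP : GaugeConfig 4 L (Matrix.unitaryGroup (Fin 3) ℂ) → ℝ → ℂ := fun V m =>
      (wilsonDirac (unitaryFundamentalRep (Fin 3) ℂ)
        (fun e => if (e.1 e.2).val + 1 = L then -V e else V e) m 1).det;
    let tile : Site 4 L → GaugeConfig 4 L (Matrix.unitaryGroup (Fin 3) ℂ) →
        GaugeConfig 4 L (Matrix.unitaryGroup (Fin 3) ℂ) := fun c V e =>
      if (e.1 e.2 - c e.2).val % 2 = 0 then V (fun ν => c ν + (((e.1 ν - c ν).val % 2 : ℕ) : ZMod L), e.2)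
      else (V (fun ν => c ν + (((Site.shift e.1 e.2 ν - c ν).val % 2 : ℕ) : ZMod L), e.2))⁻¹;
    let dfc : GaugeConfig 4 L (Matrix.unitaryGroup (Fin 3) ℂ) → Plaquette 4 L → ℝ := fun V p =>
      3 - (unitaryFundamentalRep (Fin 3) ℂ (plaquetteHolonomy V p.1 p.2.1.1 p.2.1.2)).trace.re;
    let inCell : Site 4 L → Plaquette 4 L → Prop := fun c p =>
      p.1 p.2.1.1 = c p.2.1.1 ∧ p.1 p.2.1.2 = c p.2.1.2 ∧
        ∀ ν, ν ≠ p.2.1.1 → ν ≠ p.2.1.2 → (p.1 ν = c ν ∨ p.1 ν = c ν + 1);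
    ∀ (V : GaugeConfig 4 L (Matrix.unitaryGroup (Fin 3) ℂ)) (cell : Site 4 L) (m : ℝ), |m| ≤ ε →
      (∀ p, inCell cell p → dfc V p < δ₀) →
        (dAP (tile cell V) m).re ≤
          Real.exp (K₀ - c * ((L : ℝ) ^ 4 / 4) * ∑ p ∈ univ.filter (fun p => inCell cell p), dfc V p) *
            ‖dAP 1 m‖) :
    ∃ ε δ c₁ K C : ℝ, 0 < ε ∧ 0 < δ ∧ 0 < c₁ ∧ ∃ L₀ : ℕ, ∀ (L : ℕ) [NeZero L], Even L → L₀ ≤ L → let apDet : Literature.MathematicalPhysics.QuantumFieldTheory.GaugeConfig 4 L (Matrix.specialUnitaryGroup (Fin 3) ℂ) → ℝ → ℂ := fun U m => Literature.MathematicalPhysics.QuantumLattice.fermionDet (Literature.MathematicalPhysics.QuantumLattice.wilsonDirac (Literature.MathematicalPhysics.QuantumLattice.unitaryFundamentalRep (Fin 3) ℂ) (fun e => if e.1 e.2 = -1 then -(⟨(U e).1, Matrix.specialUnitaryGroup_le_unitaryGroup (U e).2⟩ : Matrix.unitaryGroup (Fin 3) ℂ) else ⟨(U e).1, Matrix.specialUnitaryGroup_le_unitaryGroup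 (U e).2⟩) m 1); let dfc : Literature.MathematicalPhysics.QuantumFieldTheory.GaugeConfig 4 L (Matrix.specialUnitaryGroup (Fin 3) ℂ) → Literature.MathematicalPhysics.QuantumFieldTheory.Plaquette 4 L → ℝ := fun U p => 3 - (Literature.MathematicalPhysics.QuantumLattice.fundamentalRep (Fin 3) (Literature.MathematicalPhysics.QuantumFieldTheory.plaquetteHolonomy U p.1 p.2.1.1 p.2.1.2)).trace.re; ∀ m : ℝ, |m| ≤ ε → ∀ U : Literature.MathematicalPhysics.QuantumFieldTheory.GaugeConfig 4 L (Matrix.specialUnitaryGroup (Fin 3) ℂ), ‖apDet U m‖ ≤ Real.exp (K - c₁ * (∑ p ∈ Finset.univ.filter (fun p => dfc U p < δ), dfc U p) + C * ((Finset.univ.filter (fun p => δ ≤ dfc U p)).card : ℝ)) * ‖apDet 1 m‖ := by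
  obtain ⟨δ₀, cg, K₀, ε₁, hδ₀, hcg, hε₁, L₁, hGain⟩ := hCG
  obtain ⟨h₁, hHad⟩ := stub_hadamardUpper
  obtain ⟨h₂, ε₂, hε₂, L₂, hSym⟩ := stub_freeSymbolSum
  have hH₁0 : (0 : ℝ) ≤ max h₁ 0 := le_max_right _ _
  have hH₂0 : (0 : ℝ) ≤ max h₂ 0 := le_max_right _ _
  refine ⟨min ε₁ (min ε₂ (1 / 2)), δ₀, cg, |K₀|, 4 * (max h₁ 0 + max h₂ 0) + 144 * cg,
    lt_min hε₁ (lt_min hε₂ (by norm_num)), hδ₀, hcg, max (max L₁ L₂) 4, ?_⟩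
  intro L _ hLeven hL apDet dfc m hm U
  -- the constants in range
  have hL₁ : L₁ ≤ L := le_trans (le_trans (le_max_left _ _) (le_max_left _ _)) hL
  have hL₂ : L₂ ≤ L := le_trans (le_trans (le_max_right _ _) (le_max_left _ _)) hL
  have hL4 : 4 ≤ L := le_trans (le_max_right _ _) hL
  have hL2 : 2 ≤ L := le_trans (by norm_num) hL4
  have hm₁ : |m| ≤ ε₁ := le_trans hm (min_le_left _ _)
  have hm₂ : |m| ≤ ε₂ := le_trans hm (le_trans (min_le_right _ _) (min_le_left _ _))
  have hmhalf : |m| ≤ 1 / 2 := le_trans hm (le_trans (min_le_right _ _) (min_le_right _ _))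
  have hm1 : |m| ≤ 1 := hmhalf.trans (by norm_num)
  have hmneg : -1 < m := by
    have := neg_abs_le m
    linarith
  -- the `U(3)` side (local abbreviations): the plain lift, the stubs' determinant, tiling, deficits, cells
  let V : GaugeConfig 4 L (Matrix.unitaryGroup (Fin 3) ℂ) := unitaryLift U
  let dAP : GaugeConfig 4 L (Matrix.unitaryGroup (Fin 3) ℂ) → ℂ := fun W =>
    (wilsonDirac (unitaryFundamentalRep (Fin 3) ℂ) (fun e => if (e.1 e.2).val + 1 = L then -W e else W e) m 1).det
  let tile : Site 4 L → GaugeConfig 4 L (Matrix.unitaryGroup (Fin 3) ℂ) →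
      GaugeConfig 4 L (Matrix.unitaryGroup (Fin 3) ℂ) := fun c W e =>
    if (e.1 e.2 - c e.2).val % 2 = 0 then W (fun ν => c ν + (((e.1 ν - c ν).val % 2 : ℕ) : ZMod L), e.2)
    else (W (fun ν => c ν + (((Site.shift e.1 e.2 ν - c ν).val % 2 : ℕ) : ZMod L), e.2))⁻¹
  let d : Plaquette 4 L → ℝ := fun p =>
    3 - (unitaryFundamentalRep (Fin 3) ℂ (plaquetteHolonomy V p.1 p.2.1.1 p.2.1.2)).trace.re
  let P : Site 4 L → Plaquette 4 L → Prop := fun c p =>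
    p.1 p.2.1.1 = c p.2.1.1 ∧ p.1 p.2.1.2 = c p.2.1.2 ∧ ∀ ν, ν ≠ p.2.1.1 → ν ≠ p.2.1.2 → (p.1 ν = c ν ∨ p.1 ν = c ν + 1)
  -- dictionary crux ↔ stubs
  have e1 : apDet U m = dAP V :=
    congrArg (fun F => (wilsonDirac (unitaryFundamentalRep (Fin 3) ℂ) F m 1).det) (apField_eq U)
  have e2 : apDet 1 m = dAP 1 :=
    congrArg (fun F => (wilsonDirac (unitaryFundamentalRep (Fin 3) ℂ) F m 1).det)
      (apField_eq (1 : GaugeConfig 4 L (Matrix.specialUnitaryGroup (Fin 3) ℂ)))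
  have hdef : ∀ p, dfc U p = d p := fun p => deficit_unitaryLift U p
  -- the landed stubs at this `L`, in the local abbreviations
  have hG : ∀ c : Site 4 L, (∀ p, P c p → d p < δ₀) →
      (dAP (tile c V)).re ≤ Real.exp (K₀ - cg * ((L : ℝ) ^ 4 / 4) * ∑ p ∈ univ.filter (fun p => P c p), d p) * ‖dAP 1‖ :=
    fun c hc => hGain L hLeven hL₁ V c m hm₁ hc
  have hH : ∀ W : GaugeConfig 4 L (Matrix.unitaryGroup (Fin 3) ℂ), ‖dAP W‖ ≤ Real.exp (h₁ * (L : ℝ) ^ 4) :=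
    fun W => hHad L W m hm1
  obtain ⟨hReal, hChess⟩ : (∀ c : Site 4 L, 0 ≤ (dAP (tile c V)).re ∧ (dAP (tile c V)).im = 0) ∧
      ‖dAP V‖ ^ (L ^ 4) ≤ ∏ c : Site 4 L, (dAP (tile c V)).re :=
    stub_quarkChessboard_of_schwarz stub_backgroundSchwarz 3 L hLeven hL4 V m hmneg
  obtain ⟨hCellCard, hFour⟩ : (∀ c : Site 4 L, (univ.filter (fun p => P c p)).card ≤ 24) ∧
      (∀ p : Plaquette 4 L, (univ.filter (fun c => P c p)).card = 4) := stub_cellIncidence L hL2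
  -- the free determinant from below
  let s : Site 4 L → ℝ := fun k =>
    (m + ∑ μ : Fin 4, (1 - Real.cos ((2 * ((k μ).val : ℝ) + 1) * Real.pi / L))) ^ 2 +
      ∑ μ : Fin 4, Real.sin ((2 * ((k μ).val : ℝ) + 1) * Real.pi / L) ^ 2
  have hFprod : ‖dAP 1‖ = ∏ k, s k ^ 6 := by
    have hsq : ‖dAP 1‖ ^ 2 = ∏ k, s k ^ 12 := stub_freeDetFormula L m
    have hP0 : 0 ≤ ∏ k, s k ^ 6 := Finset.prod_nonneg fun k _ => by positivity
    refine (pow_left_inj₀ (norm_nonneg _) hP0 two_ne_zero).1 ?_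
    rw [hsq, ← Finset.prod_pow]
    exact Finset.prod_congr rfl fun k _ => by ring
  have hFlow : Real.exp (-(max h₂ 0 * (L : ℝ) ^ 4)) ≤ ‖dAP 1‖ := by
    rw [hFprod]
    refine le_trans (Real.exp_le_exp.2 ?_) (hSym L hL₂ m hm₂)
    have : h₂ * (L : ℝ) ^ 4 ≤ max h₂ 0 * (L : ℝ) ^ 4 := mul_le_mul_of_nonneg_right (le_max_left _ _) (by positivity)
    linarith
  have hFpos : 0 < ‖dAP 1‖ := lt_of_lt_of_le (Real.exp_pos _) hFlow
  -- the exponent attached to a cell: the gain for a good cell, the Hadamard price for a bad one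
  let f : Site 4 L → ℝ := fun c => if (∀ p, P c p → d p < δ₀) then
      K₀ - cg * ((L : ℝ) ^ 4 / 4) * ∑ p ∈ univ.filter (fun p => P c p), d p else (max h₁ 0 + max h₂ 0) * (L : ℝ) ^ 4
  have hcell : ∀ c, (dAP (tile c V)).re ≤ Real.exp (f c) * ‖dAP 1‖ := by
    intro c
    by_cases hg : ∀ p, P c p → d p < δ₀
    · rw [show f c = _ from if_pos hg]
      exact hG c hg
    · rw [show f c = _ from if_neg hg]
      calc (dAP (tile c V)).re ≤ ‖dAP (tile c V)‖ := Complex.re_le_norm _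
        _ ≤ Real.exp (h₁ * (L : ℝ) ^ 4) := hH _
        _ ≤ Real.exp (max h₁ 0 * (L : ℝ) ^ 4) :=
          Real.exp_le_exp.2 (mul_le_mul_of_nonneg_right (le_max_left _ _) (by positivity))
        _ = Real.exp (max h₁ 0 * (L : ℝ) ^ 4) *
              (Real.exp (max h₂ 0 * (L : ℝ) ^ 4) * Real.exp (-(max h₂ 0 * (L : ℝ) ^ 4))) := by
          rw [← Real.exp_add, add_neg_cancel, Real.exp_zero, mul_one]
        _ ≤ Real.exp (max h₁ 0 * (L : ℝ) ^ 4) * (Real.exp (max h₂ 0 * (L : ℝ) ^ 4) * ‖dAP 1‖) := by gcongr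
        _ = Real.exp ((max h₁ 0 + max h₂ 0) * (L : ℝ) ^ 4) * ‖dAP 1‖ := by rw [add_mul, Real.exp_add]; ring
  -- product over the cells and the bookkeeping of the exponents
  have hcard : Fintype.card (Site 4 L) = L ^ 4 := by
    simp only [Fintype.card_pi, ZMod.card, Finset.prod_const, Finset.card_univ, Fintype.card_fin]
  have hprod : ∏ c : Site 4 L, (dAP (tile c V)).re ≤ Real.exp (∑ c : Site 4 L, f c) * ‖dAP 1‖ ^ (L ^ 4) := by
    calc ∏ c : Site 4 L, (dAP (tile c V)).re ≤ ∏ c : Site 4 L, (Real.exp (f c) * ‖dAP 1‖) :=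
          Finset.prod_le_prod (fun c _ => (hReal c).1) (fun c _ => hcell c)
      _ = Real.exp (∑ c : Site 4 L, f c) * ‖dAP 1‖ ^ (L ^ 4) := by
          rw [Finset.prod_mul_distrib, Real.exp_sum, Finset.prod_const, Finset.card_univ, hcard]
  let E : ℝ := |K₀| - cg * (∑ p ∈ univ.filter (fun p => d p < δ₀), d p) +
    (4 * (max h₁ 0 + max h₂ 0) + 144 * cg) * ((univ.filter (fun p => δ₀ ≤ d p)).card : ℝ)
  have hex : ∑ c : Site 4 L, f c ≤ (L : ℝ) ^ 4 * E :=
    sum_cells_le P d (fun p => deficit_mem V p) hcg.le (add_nonneg hH₁0 hH₂0) (by positivity)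
      (by exact_mod_cast hcard.le) hCellCard hFour f (fun c hc => (if_pos hc).le) (fun c hc => (if_neg hc).le)
  have hpow : ‖dAP V‖ ^ (L ^ 4) ≤ (Real.exp E * ‖dAP 1‖) ^ (L ^ 4) := by
    calc ‖dAP V‖ ^ (L ^ 4) ≤ ∏ c : Site 4 L, (dAP (tile c V)).re := hChess
      _ ≤ Real.exp (∑ c : Site 4 L, f c) * ‖dAP 1‖ ^ (L ^ 4) := hprod
      _ ≤ Real.exp ((L : ℝ) ^ 4 * E) * ‖dAP 1‖ ^ (L ^ 4) := by gcongr
      _ = (Real.exp E * ‖dAP 1‖) ^ (L ^ 4) := by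
          rw [mul_pow, ← Real.exp_nat_mul]; push_cast; ring_nf
  have hroot : ‖dAP V‖ ≤ Real.exp E * ‖dAP 1‖ :=
    (pow_le_pow_iff_left₀ (norm_nonneg _) (by positivity) (pow_ne_zero 4 (NeZero.ne L))).1 hpow
  -- back to the crux's notation
  rw [e1, e2]
  simp only [hdef]
  exact hroot

end Reduction

/-- **The crux on even tori from the one-loop margin alone**: P6 (`stub_oneLoopMargin`'s statement) implies
`CriticalLineDiamagnetism` restricted to `Even L`, through the landed assembly
`stub_cellGain_of_gauged ∘ stub_cellGainTilingGlue ∘ stub_cellRegauge ∘ stub_cellGainCore` and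
`Reduction.evenHalf_of_cellGain`. -/
theorem evenHalf_of_oneLoopMargin : (∃ cq Cq Kq ε η₀ : ℝ, 0 < cq ∧ 0 < ε ∧ 0 < η₀ ∧ ∃ M₀ : ℕ, ∀ (M : ℕ) [NeZero M], M₀ ≤ M → ∀ (m : ℝ), |m| ≤ ε → ∀ (V : GaugeConfig 4 (2 * M) (Matrix.unitaryGroup (Fin 3) ℂ)) (c : Site 4 (2 * M)) (ω : Matrix.unitaryGroup (Fin 3) ℂ) (ζ : (Fin 4 → Fin M) → Fin 4 → Matrix.unitaryGroup (Fin 3) ℂ), ((ω : Matrix.unitaryGroup (Fin 3) ℂ) : Matrix (Fin 3) (Fin 3) ℂ) = Complex.exp (↑(Real.pi / (2 * M : ℕ)) * Complex.I) • (1 : Matrix (Fin 3) (Fin 3) ℂ) → (∀ k μ, ((ζ k μ : Matrix.unitaryGroup (Fin 3) ℂ) : Matrix (Fin 3) (Fin 3) ℂ) = Complex.exp (Real.pi * Complex.I * ((k μ : ℕ) : ℂ) / (M : ℂ)) • (1 : Matrix (Fin 3) (Fin 3) ℂ)) → ∀ η : ℝ, η ≤ η₀ → (∀ e : Edge 4 (2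 * M), ((∀ ν, (e.1 ν - c ν).val ≤ 1) ∧ (e.1 e.2 - c e.2).val = 0) → 3 - ((V e : Matrix.unitaryGroup (Fin 3) ℂ) : Matrix (Fin 3) (Fin 3) ℂ).trace.re ≤ η) → let tile : Site 4 (2 * M) → GaugeConfig 4 (2 * M) (Matrix.unitaryGroup (Fin 3) ℂ) → GaugeConfig 4 (2 * M) (Matrix.unitaryGroup (Fin 3) ℂ) := fun c V e => if (e.1 e.2 - c e.2).val % 2 = 0 then V (fun ν => c ν + (((e.1 ν - c ν).val % 2 : ℕ) : ZMod (2 * M)), e.2) else (V (fun ν => c ν + (((Site.shift e.1 e.2 ν - c ν).val % 2 : ℕ) : ZMod (2 * M)), e.2))⁻¹; let Wc : GaugeConfig 4 2 (Matrix.unitaryGroup (Fin 3) ℂ) := fun e => tile c V (fun ν => c ν + (((e.1 ν).val : ℕ) : ZMod (2 * M)), e.2); let R : (Fin 4 → Fin M) → Matrix (TorusSite 4 2 × Fin 3 × Fin 4) (TorusSite 4 2 × Fin 3 × Fin 4) ℂ := fun k => (wilsonDirac (unitaryFundamentalRep (Fin 3) ℂ) (fun e : Edge 4 2 => ζ k e.2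 * ω) m 1)⁻¹ * (wilsonDirac (unitaryFundamentalRep (Fin 3) ℂ) (fun e : Edge 4 2 => ζ k e.2 * ω * Wc e) m 1 - wilsonDirac (unitaryFundamentalRep (Fin 3) ℂ) (fun e : Edge 4 2 => ζ k e.2 * ω) m 1); ∑ k : Fin 4 → Fin M, ((R k).trace.re - ((R k) * (R k)).trace.re / 2) ≤ Kq - cq * (M : ℝ) ^ 4 * ∑ p ∈ univ.filter (fun p : Plaquette 4 (2 * M) => p.1 p.2.1.1 = c p.2.1.1 ∧ p.1 p.2.1.2 = c p.2.1.2 ∧ ∀ ν, ν ≠ p.2.1.1 → ν ≠ p.2.1.2 → (p.1 ν = c ν ∨ p.1 ν = c ν + 1)), (3 - (unitaryFundamentalRep (Fin 3) ℂ (plaquetteHolonomy V p.1 p.2.1.1 p.2.1.2)).trace.re) + Cq * Real.sqrt η * (M : ℝ) ^ 4 * ∑ e ∈ univ.filter (fun e : Edge 4 (2 * M) => (∀ ν, (e.1 ν - c ν).val ≤ 1) ∧ (e.1 e.2 - c e.2).val = 0), (3 - ((V e : Matrix.unitaryGroup (Fin 3) ℂ) : Matrix (Fin 3) (Fin 3)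 ℂ).trace.re)) → ∃ ε δ c₁ K C : ℝ, 0 < ε ∧ 0 < δ ∧ 0 < c₁ ∧ ∃ L₀ : ℕ, ∀ (L : ℕ) [NeZero L], Even L → L₀ ≤ L → let apDet : Literature.MathematicalPhysics.QuantumFieldTheory.GaugeConfig 4 L (Matrix.specialUnitaryGroup (Fin 3) ℂ) → ℝ → ℂ := fun U m => Literature.MathematicalPhysics.QuantumLattice.fermionDet (Literature.MathematicalPhysics.QuantumLattice.wilsonDirac (Literature.MathematicalPhysics.QuantumLattice.unitaryFundamentalRep (Fin 3) ℂ) (fun e => if e.1 e.2 = -1 then -(⟨(U e).1, Matrix.specialUnitaryGroup_le_unitaryGroup (U e).2⟩ : Matrix.unitaryGroup (Fin 3) ℂ) else ⟨(U e).1, Matrix.specialUnitaryGroup_le_unitaryGroup (U e).2⟩) m 1); let dfc : Literature.MathematicalPhysics.QuantumFieldTheory.GaugeConfig 4 L (Matrix.specialUnitaryGroup (Fin 3) ℂ) → Literature.MathematicalPhysics.QuantumFieldTheory.Plaquette 4 L → ℝ := fun U p => 3 - (Literature.MathematicalPhysics.QuantumLattice.fundamentalRep (Fin 3) (Literature.MathematicalPhysics.QuantumFieldTheory.plaquetteHolonomy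 U p.1 p.2.1.1 p.2.1.2)).trace.re; ∀ m : ℝ, |m| ≤ ε → ∀ U : Literature.MathematicalPhysics.QuantumFieldTheory.GaugeConfig 4 L (Matrix.specialUnitaryGroup (Fin 3) ℂ), ‖apDet U m‖ ≤ Real.exp (K - c₁ * (∑ p ∈ Finset.univ.filter (fun p => dfc U p < δ), dfc U p) + C * ((Finset.univ.filter (fun p => δ ≤ dfc U p)).card : ℝ)) * ‖apDet 1 m‖ := fun hP6 =>
  Reduction.evenHalf_of_cellGain
    (stub_cellGain_of_gauged (stub_cellGainTilingGlue (stub_cellRegauge (stub_cellGainCore hP6))))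

/-- **Stub `stub_reduction` — the composition of line `Sketch`.**  The one-loop margin P6 (`stub_oneLoopMargin`)
and the crux on odd tori (`stub_oddHalf`) imply `CriticalLineDiamagnetism`: the even half is
`evenHalf_of_oneLoopMargin`, and `Reduction.crux_of_halves` merges the constants of the two halves. -/
theorem stub_reduction : (∃ cq Cq Kq ε η₀ : ℝ, 0 < cq ∧ 0 < ε ∧ 0 < η₀ ∧ ∃ M₀ : ℕ, ∀ (M : ℕ) [NeZero M], M₀ ≤ M → ∀ (m : ℝ), |m| ≤ ε → ∀ (V : GaugeConfig 4 (2 * M) (Matrix.unitaryGroup (Fin 3) ℂ)) (c : Site 4 (2 * M)) (ω : Matrix.unitaryGroup (Fin 3) ℂ) (ζ : (Fin 4 → Fin M) → Fin 4 → Matrix.unitaryGroup (Fin 3) ℂ), ((ω : Matrix.unitaryGroup (Fin 3) ℂ) : Matrix (Fin 3) (Fin 3) ℂ) = Complex.exp (↑(Real.pi / (2 * M : ℕ)) * Complex.I) • (1 : Matrix (Fin 3) (Fin 3) ℂ) → (∀ k μ, ((ζ k μ : Matrix.unitaryGroup (Fin 3) ℂ) : Matrix (Fin 3) (Fin 3)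 ℂ) = Complex.exp (Real.pi * Complex.I * ((k μ : ℕ) : ℂ) / (M : ℂ)) • (1 : Matrix (Fin 3) (Fin 3) ℂ)) → ∀ η : ℝ, η ≤ η₀ → (∀ e : Edge 4 (2 * M), ((∀ ν, (e.1 ν - c ν).val ≤ 1) ∧ (e.1 e.2 - c e.2).val = 0) → 3 - ((V e : Matrix.unitaryGroup (Fin 3) ℂ) : Matrix (Fin 3) (Fin 3) ℂ).trace.re ≤ η) → let tile : Site 4 (2 * M) → GaugeConfig 4 (2 * M) (Matrix.unitaryGroup (Fin 3) ℂ) → GaugeConfig 4 (2 * M) (Matrix.unitaryGroup (Fin 3) ℂ) := fun c V e => if (e.1 e.2 - c e.2).val % 2 = 0 then V (fun ν => c ν + (((e.1 ν - c ν).val % 2 : ℕ) : ZMod (2 * M)), e.2) else (V (fun ν => c ν + (((Site.shift e.1 e.2 ν - c ν).val % 2 : ℕ) : ZMod (2 * M)), e.2))⁻¹; let Wc : GaugeConfig 4 2 (Matrix.unitaryGroup (Fin 3) ℂ) := fun e => tile c V (fun ν => c ν + (((e.1 ν).val : ℕ) : ZMod (2 * M)), e.2); let R : (Fin 4 → Fin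 M) → Matrix (TorusSite 4 2 × Fin 3 × Fin 4) (TorusSite 4 2 × Fin 3 × Fin 4) ℂ := fun k => (wilsonDirac (unitaryFundamentalRep (Fin 3) ℂ) (fun e : Edge 4 2 => ζ k e.2 * ω) m 1)⁻¹ * (wilsonDirac (unitaryFundamentalRep (Fin 3) ℂ) (fun e : Edge 4 2 => ζ k e.2 * ω * Wc e) m 1 - wilsonDirac (unitaryFundamentalRep (Fin 3) ℂ) (fun e : Edge 4 2 => ζ k e.2 * ω) m 1); ∑ k : Fin 4 → Fin M, ((R k).trace.re - ((R k) * (R k)).trace.re / 2) ≤ Kq - cq * (M : ℝ) ^ 4 * ∑ p ∈ univ.filter (fun p : Plaquette 4 (2 * M) => p.1 p.2.1.1 = c p.2.1.1 ∧ p.1 p.2.1.2 = c p.2.1.2 ∧ ∀ ν, ν ≠ p.2.1.1 → ν ≠ p.2.1.2 → (p.1 ν = c ν ∨ p.1 ν = c ν + 1)), (3 - (unitaryFundamentalRep (Fin 3) ℂ (plaquetteHolonomy V p.1 p.2.1.1 p.2.1.2)).trace.re) + Cq * Real.sqrt η * (M : ℝ) ^ 4 * ∑ e ∈ univ.filter (fun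 e : Edge 4 (2 * M) => (∀ ν, (e.1 ν - c ν).val ≤ 1) ∧ (e.1 e.2 - c e.2).val = 0), (3 - ((V e : Matrix.unitaryGroup (Fin 3) ℂ) : Matrix (Fin 3) (Fin 3) ℂ).trace.re)) → (∃ ε δ c₁ K C : ℝ, 0 < ε ∧ 0 < δ ∧ 0 < c₁ ∧ ∃ L₀ : ℕ, ∀ (L : ℕ) [NeZero L], Odd L → L₀ ≤ L → let apDet : Literature.MathematicalPhysics.QuantumFieldTheory.GaugeConfig 4 L (Matrix.specialUnitaryGroup (Fin 3) ℂ) → ℝ → ℂ := fun U m => Literature.MathematicalPhysics.QuantumLattice.fermionDet (Literature.MathematicalPhysics.QuantumLattice.wilsonDirac (Literature.MathematicalPhysics.QuantumLattice.unitaryFundamentalRep (Fin 3) ℂ) (fun e => if e.1 e.2 = -1 then -(⟨(U e).1, Matrix.specialUnitaryGroup_le_unitaryGroup (U e).2⟩ : Matrix.unitaryGroup (Fin 3) ℂ) else ⟨(U e).1, Matrix.specialUnitaryGroup_le_unitaryGroup (U e).2⟩) m 1); let dfc : Literature.MathematicalPhysics.QuantumFieldTheory.GaugeConfig 4 L (Matrix.specialUnitaryGroup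 (Fin 3) ℂ) → Literature.MathematicalPhysics.QuantumFieldTheory.Plaquette 4 L → ℝ := fun U p => 3 - (Literature.MathematicalPhysics.QuantumLattice.fundamentalRep (Fin 3) (Literature.MathematicalPhysics.QuantumFieldTheory.plaquetteHolonomy U p.1 p.2.1.1 p.2.1.2)).trace.re; ∀ m : ℝ, |m| ≤ ε → ∀ U : Literature.MathematicalPhysics.QuantumFieldTheory.GaugeConfig 4 L (Matrix.specialUnitaryGroup (Fin 3) ℂ), ‖apDet U m‖ ≤ Real.exp (K - c₁ * (∑ p ∈ Finset.univ.filter (fun p => dfc U p < δ), dfc U p) + C * ((Finset.univ.filter (fun p => δ ≤ dfc U p)).card : ℝ)) * ‖apDet 1 m‖) → Theses.QuarksAsStableAction.CriticalLineDiamagnetism := by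
  intro hP6 hOdd
  exact Reduction.crux_of_halves (evenHalf_of_oneLoopMargin hP6) hOdd

end Summit.QuantumFields.QCD.Cruxes.CriticalLineDiamagnetism.ChessboardCellGain

end
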